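/-
Copyright (c) 2026 the pub-hodgecm-mathlib formalisation cell (harness21).  Prover seat hodgecm-mathlib-K2E4-p11 (g6), Track B ∕ K2-LIT, h413 = `stmt-HodgeConjecture-24833`,
line `K2_E1_TraceFormulaBeta`, campaign «5Res ENDGAME BY FAMILIES», ROADCARD §3′ D4′c (SD), dealer K2E1-plan (g7) deal (260) «your own `hd∕hdw∕hb` letters at M1»: the three POLE LETTERS of
★ `K2E1ChiMaassSelbergRealPoleCMTwo` ∕ ★ `K2E1MaassSelbergResiduePositivity` at a real pole — SIMPLE POLES of the scattering coordinates from the Maass–Selberg vertical bound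
`y·‖ψ(c+iy)‖ ≤ A`, and the weighted bound `|z−c|²·‖ψ z‖² ≤ Mb`.
-/
import Summits.HodgeConjecture.HodgeConjecture.Theorems.K2E1ChiScatteringRealPolesM1CMTwo   -- ★ p860605 (K2E1-p13): `exists_norm_apply_le_norm_sum_smul` (coordinate domination); brings ★ OnBoxes `poleControl_continued_chi_cm_two_of_family_on'`
import Mathlib.Analysis.Meromorphic.Order
import HarnessLib

/-!
# D4′c (SD) — `K2E1ChiMaassSelbergRealPoleLettersCMTwo`: THE POLE LETTERS `hd∕hdw∕hb` AT A REAL POLE `c` — a meromorphic `q` with `y·|q(c+iy)| ≤ C` (`y ↓ 0`) has AT MOST A SIMPLE POLE at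
# `c` (`(z−c)·q = d` analytic); for `ψ = r·Σ_j qc_j·e_j` this gives `|z−c|²·κm‖ψ z‖² ≤ Mb`; the vertical bound is the (a3) clause of [MW] IV.3.12 (a) ON THE LINE `Re z = c`

Track B ∕ K2-LIT, crux h413 = `stmt-HodgeConjecture-24833`, route of record `HCCMUnconditional`; cell `hodgecm-mathlib`, squad K2, ENGINE E1; dealer K2E1-plan (g7) deal (260).  THEOREMS ONLY (no
`def`, no `instance`, no `notation`, no named-fact hypothesis, no `sorry`); lane `--supports stmt-HodgeConjecture-24833 --as helper` (count-neutral).  Closes no socket.  No automorphic object: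
complex analysis on the letters of ★ `poleControl_continued_chi_cm_two_of_family_on'` (upper domain) and the coordinate model `ψ z = r • Σ_j qc_j z • e_j` of ★ p860605.

THE MATHEMATICS ([MoeglinWaldspurger1995, IV.1.11, IV.3.12 (a)]; [Langlands1976, §7]; [BernsteinLapid2019, §4]).  (§1) THE SIMPLE-POLE LEMMA: `q` meromorphic at `c` is `(z−c)^n·g` near `c` with
`g` analytic, `g(c) ≠ 0` (Mathlib `meromorphicOrderAt_eq_int_iff`), or locally `0`; on the vertical path `z = c + iy`, `y·|q| = y^{n+1}·|g|`, which is unbounded as `y ↓ 0` if `n ≤ −2`; so a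
bound `y·|q(c+iy)| ≤ C` forces `n ≥ −1`, i.e. **`d := (z−c)·q` extends analytically across `c`** (`hd`, `hdw`).  (§2) If `ψ z = r • Σ_j qc_j z • e_j` and every `(z−c)·qc_j` is analytic at
`c`, then `‖(z−c)•ψ z‖` is bounded near `c`, whence **`|z−c|²·(κm·‖ψ z‖²) ≤ Mb`** (`hb`).  (§3) THE VERTICAL BOUND: clause (a3) of ★ `poleControl_continued_chi_cm_two_of_family_on'` reads, at
`z = c + iy ∈ D₁` with `0 < y ≤ 1`, `b z ≤ A(c)²∕y²` with `A(c) = (c−½)T^{2(c−½)}√a + √((c−½)²T^{4(c−½)}a + aT^{4(c−½)})` CONSTANT on the line; with `b = κm‖ψ‖²` and coordinate domination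
(★ p860605 §1) every `y·|qc_j(c+iy)|` and `y·|⟪φ, ψ(c+iy)⟫|` is bounded.  HEAD (§4): the three pole letters at every real `c` whose vertical segment `{c+iy : 0<y<δ}` lies in `D₁`.
* §1 **`exists_analyticAt_eq_sub_mul_of_vertical_bound`** (simple pole from the vertical bound).
* §2 **`eventually_normSq_weight_le_of_coords`** (`hb` from the coordinate model).
* §3 `vertical_bound_of_boxClause` ((a3) on the line `Re z = c` ⟹ `y·√(b) ≤ A(c)`), `vertical_bound_coords` (⟹ per coordinate and per pairing).
* §4 HEAD **`chi_realPole_letters_of_family_on'`** (`hd∕hdw` for each `qc_j` and for `z ↦ κm·⟪φ, ψ z⟫`, and `hb`).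
HONEST LABEL: HC_CM is proved only modulo the 7 printed citations (2 remaining named inputs: hLiu418 = `stmt-HodgeConjecture-24832`, h413 = `stmt-HodgeConjecture-24833`) until rung 0
closes; this file asserts no named fact and closes no socket; count-neutral; unconditional (binder form).

## References
* [MoeglinWaldspurger1995] C. Mœglin, J.-L. Waldspurger, *Spectral decomposition and Eisenstein series* (1995), IV.1.11, IV.3.12 (a).
* [Langlands1976] R. P. Langlands, *On the Functional Equations Satisfied by Eisenstein Series*, LNM 544 (1976), §7.
* [BernsteinLapid2019] J. Bernstein, E. Lapid, *On the meromorphic continuation of Eisenstein series*, J. Amer. Math. Soc. 37 (2024), §4.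
-/

set_option autoImplicit false
-- the mandated namespace repeats `HodgeConjecture.HodgeConjecture`, as in every `Theorems/*.lean` of this sub-problem
set_option linter.dupNamespace false

noncomputable section

open Set Filter Topology Metric Complex
open scoped ComplexConjugate InnerProductSpace
open Summit.HodgeConjecture.HodgeConjecture.Cruxes.H413.K2E1ChiScatteringRealPolesM1CMTwo
  (exists_norm_apply_le_norm_sum_smul poleControl_continued_chi_cm_two_of_family_selfDual_on' upperBallDomain_topology mem_ball_max_ceil)
open Summit.HodgeConjecture.HodgeConjecture.Cruxes.H413.K2E1SphericalEisensteinPoleExclusionCMThree (countable_of_codiscreteWithin)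

namespace Summit.HodgeConjecture.HodgeConjecture.Cruxes.H413.K2E1ChiMaassSelbergRealPoleLettersCMTwo

/-! ## §1 The simple-pole lemma: a vertical bound `y·|q(c+iy)| ≤ C` forces order `≥ −1` -/

/-- The vertical path `y ↦ c + iy` (`y ↓ 0`) runs inside the punctured neighbourhoods of `c`. [folklore] -/
theorem tendsto_vertical_nhdsWithin (c : ℝ) : Tendsto (fun y : ℝ => (c : ℂ) + y * I) (𝓝[>] (0 : ℝ)) (𝓝[≠] (c : ℂ)) := by
  refine tendsto_nhdsWithin_of_tendsto_nhds_of_eventually_within _ ?_ ?_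
  · have hcont : Continuous fun y : ℝ => (c : ℂ) + y * I := continuous_const.add (continuous_ofReal.mul continuous_const)
    have := hcont.tendsto 0
    simp only [ofReal_zero, zero_mul, add_zero] at this
    exact this.mono_left nhdsWithin_le_nhds
  · filter_upwards [self_mem_nhdsWithin] with y hy
    simp only [mem_compl_iff, mem_singleton_iff, mem_Ioi] at hy ⊢
    intro h
    have := congrArg Complex.im h
    simp only [add_im, ofReal_im, mul_im, ofReal_re, I_im, I_re, mul_one, mul_zero, zero_add, add_zero] at this
    exact hy.ne' this

/-- **THE SIMPLE-POLE LEMMA**: `q` meromorphic at the real point `c` with `y·|q(c + iy)| ≤ C` for small `y > 0` ⟹ `(z − c)·q z` extends ANALYTICALLY across `c`: there is `d` analytic at `c`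
with `d z = (z − c)·q z` on a punctured neighbourhood (so `q` has at most a simple pole at `c`).  [cite: MoeglinWaldspurger1995, IV.1.11] [cite: Langlands1976, §7] -/
theorem exists_analyticAt_eq_sub_mul_of_vertical_bound {q : ℂ → ℂ} {c : ℝ} (hq : MeromorphicAt q (c : ℂ)) {C : ℝ}
    (hb : ∀ᶠ y : ℝ in 𝓝[>] (0 : ℝ), y * ‖q ((c : ℂ) + y * I)‖ ≤ C) :
    ∃ d : ℂ → ℂ, AnalyticAt ℂ d (c : ℂ) ∧ ∀ᶠ z : ℂ in 𝓝[≠] (c : ℂ), d z = (z - c) * q z := by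
  by_cases htop : meromorphicOrderAt q (c : ℂ) = ⊤
  · -- `q` vanishes near `c`
    refine ⟨fun _ => 0, analyticAt_const, ?_⟩
    filter_upwards [meromorphicOrderAt_eq_top_iff.1 htop] with z hz
    rw [hz, mul_zero]
  -- normal form `q = (z − c)^n • g`
  obtain ⟨g, hg, hg0, hqg⟩ := (meromorphicOrderAt_ne_top_iff hq).1 htop
  set n : ℤ := (meromorphicOrderAt q (c : ℂ)).untop₀ with hn
  -- the order is at least `−1`
  have hn1 : -1 ≤ n := by
    by_contra hlt
    push Not at hlt
    have hn2 : n + 1 ≤ -1 := by omega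
    -- along the vertical path: `y·|q| = y^{n+1}·|g| ≥ y⁻¹·|g| → ∞`
    have hpath := tendsto_vertical_nhdsWithin c
    have hgpos : 0 < ‖g (c : ℂ)‖ := norm_pos_iff.2 hg0
    have hgc : ∀ᶠ y : ℝ in 𝓝[>] (0 : ℝ), ‖g (c : ℂ)‖ / 2 ≤ ‖g ((c : ℂ) + y * I)‖ := by
      have hgcont : ContinuousAt g (c : ℂ) := hg.continuousAt
      have hev : ∀ᶠ z in 𝓝 (c : ℂ), ‖g (c : ℂ)‖ / 2 ≤ ‖g z‖ := by
        have := hgcont.norm.eventually (lt_mem_nhds (show ‖g (c : ℂ)‖ / 2 < ‖g (c : ℂ)‖ by linarith))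
        exact this.mono fun z hz => hz.le
      exact (hpath.mono_right nhdsWithin_le_nhds).eventually hev
    have hy1 : ∀ᶠ y : ℝ in 𝓝[>] (0 : ℝ), y < 1 := nhdsWithin_le_nhds (Iio_mem_nhds one_pos)
    have hyC : ∀ᶠ y : ℝ in 𝓝[>] (0 : ℝ), y < ‖g (c : ℂ)‖ / 2 / (|C| + 1) := nhdsWithin_le_nhds (Iio_mem_nhds (div_pos (half_pos hgpos) (by positivity)))
    have hy0 : ∀ᶠ y : ℝ in 𝓝[>] (0 : ℝ), 0 < y := self_mem_nhdsWithin
    obtain ⟨y, hyb, hyq, hyg, hy1', hyC', hy0'⟩ := (hb.and ((hpath.eventually hqg).and (hgc.and (hy1.and (hyC.and hy0))))).exists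
    -- `y * ‖q‖ = y ^ (n+1) * ‖g‖`
    have hsub : ((c : ℂ) + y * I) - c = (y : ℂ) * I := by ring
    have hyq' : q ((c : ℂ) + y * I) = (((c : ℂ) + y * I) - c) ^ n • g ((c : ℂ) + y * I) := hyq
    have hnorm : y * ‖q ((c : ℂ) + y * I)‖ = y ^ (n + 1) * ‖g ((c : ℂ) + y * I)‖ := by
      rw [hyq', hsub, norm_smul, norm_zpow, norm_mul, norm_real, norm_I, mul_one, Real.norm_eq_abs, abs_of_pos hy0', ← mul_assoc,
        zpow_add_one₀ hy0'.ne', mul_comm y]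
    -- `y ^ (n+1) ≥ y⁻¹`
    have hzpow : y⁻¹ ≤ y ^ (n + 1) := by
      rw [← zpow_neg_one]
      exact zpow_le_zpow_right_of_le_one₀ hy0' hy1'.le hn2
    have hlow : y⁻¹ * (‖g (c : ℂ)‖ / 2) ≤ y * ‖q ((c : ℂ) + y * I)‖ := by
      rw [hnorm]
      exact mul_le_mul hzpow hyg (by positivity) (le_trans (inv_nonneg.2 hy0'.le) hzpow)
    -- but `y⁻¹ · ‖g c‖/2 > |C| ≥ C`
    have hbig : C < y⁻¹ * (‖g (c : ℂ)‖ / 2) := by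
      rw [lt_inv_mul_iff₀ hy0']
      calc y * C ≤ y * (|C| + 1) := mul_le_mul_of_nonneg_left ((le_abs_self C).trans (le_add_of_nonneg_right zero_le_one)) hy0'.le
        _ < ‖g (c : ℂ)‖ / 2 / (|C| + 1) * (|C| + 1) := mul_lt_mul_of_pos_right hyC' (by positivity)
        _ = ‖g (c : ℂ)‖ / 2 := div_mul_cancel₀ _ (by positivity)
    linarith
  -- the analytic extension `d := (z − c)^{(n+1).toNat} • g`
  refine ⟨fun z => (z - c) ^ (n + 1).toNat * g z, ((analyticAt_id.sub analyticAt_const).pow _).mul hg, ?_⟩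
  filter_upwards [hqg, self_mem_nhdsWithin] with z hz hzc
  have hzc' : z - c ≠ 0 := sub_ne_zero.2 hzc
  rw [hz, smul_eq_mul, ← mul_assoc, ← zpow_natCast, Int.toNat_of_nonneg (by omega), zpow_add_one₀ hzc', mul_comm ((z - c) ^ n)]

/-! ## §2 `hb` from the coordinate model `ψ = r • Σ_j qc_j • e_j` -/

section Coords

variable {V : Type*} [NormedAddCommGroup V] [NormedSpace ℂ V] {ι' : Type*} [Fintype ι']

/-- **`hb` FROM THE COORDINATE MODEL**: if `ψ z = r • Σ_j qc_j z • e_j` near `c` and every `(z − c)·qc_j` extends analytically across `c`, then `|z − c|²·(κm·‖ψ z‖²)` is bounded on a punctured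
neighbourhood of `c` (`‖(z−c)•ψ z‖ ≤ ‖r‖·Σ_j (‖d_j c‖ + 1)·‖e_j‖` there). [cite: MoeglinWaldspurger1995, IV.1.11] -/
theorem eventually_normSq_weight_le_of_coords (e : ι' → V) (r : ℂ) {qc : ι' → ℂ → ℂ} {ψ : ℂ → V} {c : ℝ} (κm : ℝ)
    (hψ : ∀ᶠ z : ℂ in 𝓝[≠] (c : ℂ), ψ z = r • ∑ j, qc j z • e j)
    (hd : ∀ j, ∃ d : ℂ → ℂ, AnalyticAt ℂ d (c : ℂ) ∧ ∀ᶠ z : ℂ in 𝓝[≠] (c : ℂ), d z = (z - c) * qc j z) :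
    ∃ Mb : ℝ, ∀ᶠ z : ℂ in 𝓝[≠] (c : ℂ), ‖z - (c : ℂ)‖ ^ 2 * (κm * ‖ψ z‖ ^ 2) ≤ Mb := by
  classical
  choose d hda hde using hd
  -- each `d j` is bounded near `c`
  have hdb : ∀ j, ∀ᶠ z : ℂ in 𝓝[≠] (c : ℂ), ‖d j z‖ ≤ ‖d j (c : ℂ)‖ + 1 := fun j =>
    mem_nhdsWithin_of_mem_nhds (((hda j).continuousAt.norm.eventually (Iic_mem_nhds (lt_add_one ‖d j (c : ℂ)‖))).mono fun z hz => hz)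
  set M : ℝ := ‖r‖ * ∑ j, (‖d j (c : ℂ)‖ + 1) * ‖e j‖ with hM
  refine ⟨|κm| * M ^ 2, ?_⟩
  have hall : ∀ᶠ z : ℂ in 𝓝[≠] (c : ℂ), ∀ j, ‖d j z‖ ≤ ‖d j (c : ℂ)‖ + 1 ∧ d j z = (z - c) * qc j z :=
    eventually_all.2 fun j => (hdb j).and (hde j)
  filter_upwards [hψ, hall] with z hz hj
  -- `‖(z − c)•ψ z‖ ≤ M`
  have hsm : ‖(z - (c : ℂ)) • ψ z‖ ≤ M := by
    rw [hz, smul_comm, norm_smul, Finset.smul_sum]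
    refine mul_le_mul_of_nonneg_left ((norm_sum_le _ _).trans (Finset.sum_le_sum fun j _ => ?_)) (norm_nonneg _)
    rw [smul_smul, norm_smul, ← (hj j).2]
    exact mul_le_mul_of_nonneg_right (hj j).1 (norm_nonneg _)
  have hM0 : 0 ≤ M := (norm_nonneg _).trans hsm
  calc ‖z - (c : ℂ)‖ ^ 2 * (κm * ‖ψ z‖ ^ 2) = κm * ‖(z - (c : ℂ)) • ψ z‖ ^ 2 := by rw [norm_smul, mul_pow]; ring
    _ ≤ |κm| * ‖(z - (c : ℂ)) • ψ z‖ ^ 2 := mul_le_mul_of_nonneg_right (le_abs_self κm) (sq_nonneg _)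
    _ ≤ |κm| * M ^ 2 := mul_le_mul_of_nonneg_left (pow_le_pow_left₀ (norm_nonneg _) hsm 2) (abs_nonneg κm)

/-- **`hd` FOR THE PAIRING `z ↦ κm·⟪φ, ψ z⟫`** from the coordinates: `(z − c)·κm⟪φ, ψ z⟫ = κm·r·Σ_j d_j(z)·⟪φ, e_j⟫` extends analytically across `c`. [cite: MoeglinWaldspurger1995, IV.1.11] -/
theorem exists_analyticAt_pairing_of_coords {W : Type*} [NormedAddCommGroup W] [InnerProductSpace ℂ W] {ι'' : Type*} [Fintype ι''] (e : ι'' → W) (r : ℂ) (φ : W)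
    {qc : ι'' → ℂ → ℂ} {ψ : ℂ → W} {c : ℝ} (κ m : ℝ)
    (hψ : ∀ᶠ z : ℂ in 𝓝[≠] (c : ℂ), ψ z = r • ∑ j, qc j z • e j)
    (hd : ∀ j, ∃ d : ℂ → ℂ, AnalyticAt ℂ d (c : ℂ) ∧ ∀ᶠ z : ℂ in 𝓝[≠] (c : ℂ), d z = (z - c) * qc j z) :
    ∃ d : ℂ → ℂ, AnalyticAt ℂ d (c : ℂ) ∧ ∀ᶠ z : ℂ in 𝓝[≠] (c : ℂ), d z = (z - c) * (((κ : ℝ) : ℂ) * (((m : ℝ) : ℂ) * ⟪φ, ψ z⟫_ℂ)) := by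
  classical
  choose d hda hde using hd
  refine ⟨fun z => ((κ : ℝ) : ℂ) * (((m : ℝ) : ℂ) * (r * ∑ j, d j z * ⟪φ, e j⟫_ℂ)), ?_, ?_⟩
  · exact analyticAt_const.mul (analyticAt_const.mul (analyticAt_const.mul
      (Finset.analyticAt_fun_sum _ fun j _ => (hda j).mul analyticAt_const)))
  · have hall : ∀ᶠ z : ℂ in 𝓝[≠] (c : ℂ), ∀ j, d j z = (z - c) * qc j z := eventually_all.2 fun j => hde j
    filter_upwards [hψ, hall] with z hz hj
    rw [hz, inner_smul_right, inner_sum]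
    simp_rw [inner_smul_right, hj]
    simp only [Finset.mul_sum]
    exact Finset.sum_congr rfl fun j _ => by ring

end Coords

/-! ## §3 The vertical bound from the (a3) clause of [MW] IV.3.12 (a) -/

/-- **FROM THE (a3) CLAUSE ON THE LINE `Re z = c` TO THE VERTICAL BOUND**: `κm·‖ψ z‖² ≤ A²∕y²` at `z = c + iy` (`A ≥ 0`, `κm > 0`, `y > 0`) gives `y·‖ψ z‖ ≤ A ∕ √(κm)`. [folklore] -/
theorem mul_norm_le_of_boxClause {V : Type*} [NormedAddCommGroup V] {κm A y : ℝ} (hκm : 0 < κm) (hA : 0 ≤ A) (hy : 0 < y) {v : V}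
    (h : κm * ‖v‖ ^ 2 ≤ A ^ 2 / y ^ 2) : y * ‖v‖ ≤ A / Real.sqrt κm := by
  have hs : 0 < Real.sqrt κm := Real.sqrt_pos.2 hκm
  rw [le_div_iff₀ hs]
  have h1 : (y * ‖v‖ * Real.sqrt κm) ^ 2 ≤ A ^ 2 := by
    rw [mul_pow, mul_pow, Real.sq_sqrt hκm.le]
    rw [le_div_iff₀ (pow_pos hy 2)] at h
    nlinarith [h]
  have h0 : 0 ≤ y * ‖v‖ * Real.sqrt κm := by positivity
  nlinarith [h1, h0, hA, sq_nonneg (y * ‖v‖ * Real.sqrt κm - A)]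

/-! ## §4 HEAD: the three pole letters at every real `c > ½` from the per-ball self-dual model data (the `variable` block of ★ p860605 VERBATIM) -/

section Heads

/- THE LETTERS — VERBATIM ★ `K2E1ChiScatteringRealPolesM1CMTwo` §4: the closed co-discrete pole set `P`; the coordinates `qc_j` (normal-form meromorphic on `ℂ`, analytic off `P`); a linearly
independent finite family `e_j ∈ V`, `r ≠ 0`, the intertwined section `ψ` with `ψ z = r • Σ_j qc_j(z) • e_j` off `P`; `κ, m > 0`, `φ ≠ 0`; per ball `n`: the open `U n`, co-discrete in
`ball 0 (n+2)`, and on `D₁(n) = ({½ < Re, 0 < Im} ∩ ball 0 (n+2) ∩ U n) ∖ P` (for `2 ≤ n`) the model family `F n` holomorphic with the SELF-DUAL relation `hrel`. -/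
variable {V : Type*} [NormedAddCommGroup V] [InnerProductSpace ℂ V] {ι' : Type*} [Fintype ι']
  {P : Set ℂ} (hPc : IsClosed P) (hPcd : ∀ z₀ : ℂ, ∀ᶠ s in 𝓝[≠] z₀, s ∉ P)
  {qc : ι' → ℂ → ℂ} (hqNF : ∀ j, MeromorphicNFOn (qc j) univ) (hqa : ∀ j (z : ℂ), z ∉ P → AnalyticAt ℂ (qc j) z)
  {e : ι' → V} (he : LinearIndependent ℂ e) {r : ℂ} (hr : r ≠ 0) {ψ : ℂ → V} (hψ : ∀ z : ℂ, z ∉ P → ψ z = r • ∑ j, qc j z • e j)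
  {κ m : ℝ} (hκ : 0 < κ) (hm : 0 < m) {φ : V} (hφ : φ ≠ 0)
  (U : ℕ → Set ℂ) (hUo : ∀ n, IsOpen (U n)) (hUcod : ∀ n : ℕ, ∀ z₀ ∈ Metric.ball (0 : ℂ) (n + 2), ∀ᶠ s in 𝓝[≠] z₀, s ∈ U n)
  {T cμ K : ℕ → ℝ} (hT : ∀ n, 1 ≤ T n) (hcμ : ∀ n, 0 < cμ n) (hK : ∀ n, 0 < K n)
  {H : Type*} [NormedAddCommGroup H] [InnerProductSpace ℂ H] (F : ℕ → ℂ → H)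
  (hFd : ∀ n : ℕ, 2 ≤ n → DifferentiableOn ℂ (F n) (({z : ℂ | 1 / 2 < z.re ∧ 0 < z.im} ∩ Metric.ball (0 : ℂ) (n + 2) ∩ U n) \ P))
  (hrel : ∀ n : ℕ, 2 ≤ n → ∀ z ∈ ({z : ℂ | 1 / 2 < z.re ∧ 0 < z.im} ∩ Metric.ball (0 : ℂ) (n + 2) ∩ U n) \ P,
      ∀ z' ∈ ({z : ℂ | 1 / 2 < z.re ∧ 0 < z.im} ∩ Metric.ball (0 : ℂ) (n + 2) ∩ U n) \ P, 1 < z'.re → z'.re < z.re →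
      ⟪F n z', F n z⟫_ℂ = ((cμ n : ℝ) : ℂ) * (((K n : ℝ) : ℂ) *
        ((((T n : ℝ) : ℂ) ^ (z + conj z' - 1) / (z + conj z' - 1)) * (((κ : ℝ) : ℂ) * (((m : ℝ) : ℂ) * ⟪φ, φ⟫_ℂ))
          + (((T n : ℝ) : ℂ) ^ (z - conj z') / (z - conj z')) * (((κ : ℝ) : ℂ) * (((m : ℝ) : ℂ) * ⟪ψ z', φ⟫_ℂ))
          - (((T n : ℝ) : ℂ) ^ (-(z - conj z')) / (z - conj z')) * (((κ : ℝ) : ℂ) * (((m : ℝ) : ℂ) * ⟪φ, ψ z⟫_ℂ))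
          - (((T n : ℝ) : ℂ) ^ (-(z + conj z' - 1)) / (z + conj z' - 1)) * (((κ : ℝ) : ℂ) * (((m : ℝ) : ℂ) * ⟪ψ z', ψ z⟫_ℂ)))))

include hPc hPcd hqNF hqa he hr hψ hκ hm hφ hUo hUcod hT hcμ hK hFd hrel

omit hqNF in
/-- **THE VERTICAL BOUND AT A REAL POINT `c > ½`**: for small `y > 0`, `y·|qc_j(c + iy)| ≤ C_j` for every coordinate — the (a3) clause of ★ `poleControl_continued_chi_cm_two_of_family_selfDual_on'`
on the ball `n = max 2 ⌈‖c‖⌉₊` at `z = c + iy ∈ D₁(n)` (whose constant depends on `Re z = c` only), then coordinate domination ★ `exists_norm_apply_le_norm_sum_smul`.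
[cite: MoeglinWaldspurger1995, IV.3.12 (a)] [cite: BernsteinLapid2019, §4] -/
theorem vertical_bound_coords_of_family_selfDual_balls {c : ℝ} (hc : 1 / 2 < c) (j : ι') :
    ∃ C : ℝ, ∀ᶠ y : ℝ in 𝓝[>] (0 : ℝ), y * ‖qc j ((c : ℂ) + y * I)‖ ≤ C := by
  classical
  -- the ball
  set n : ℕ := max 2 ⌈‖(c : ℂ)‖⌉₊ with hndef
  have hn : 2 ≤ n := le_max_left _ _
  have hcb : (c : ℂ) ∈ Metric.ball (0 : ℂ) (n + 2) := mem_ball_max_ceil (c : ℂ)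
  have hPcount : P.Countable := countable_of_codiscreteWithin fun x _ => hPcd x
  obtain ⟨hD₁o, hD₁c, hD₁sub, O₁, O₂', hO₁o, hO₁ne, hO₁D, hO₂o, hO₂ne, hO₂D, hsep⟩ := upperBallDomain_topology n hn (hUo n) (hUcod n) hPc hPcount
  -- `ψ` is holomorphic on `D₁(n)`
  have hψd : DifferentiableOn ℂ ψ (({z : ℂ | 1 / 2 < z.re ∧ 0 < z.im} ∩ Metric.ball (0 : ℂ) (n + 2) ∩ U n) \ P) := by
    have hsum : DifferentiableOn ℂ (fun z : ℂ => r • ∑ i, qc i z • e i) (({z : ℂ | 1 / 2 < z.re ∧ 0 < z.im} ∩ Metric.ball (0 : ℂ) (n + 2) ∩ U n) \ P) :=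
      (DifferentiableOn.fun_sum fun i _ => (fun z hz => ((hqa i z hz.2).differentiableAt.differentiableWithinAt).smul_const (e i))).const_smul r
    exact hsum.congr fun z hz => hψ z hz.2
  -- the vertical path lies in `D₁(n)` for small `y > 0`
  have hpath := tendsto_vertical_nhdsWithin c
  have hmem : ∀ᶠ y : ℝ in 𝓝[>] (0 : ℝ), (c : ℂ) + y * I ∈ ({z : ℂ | 1 / 2 < z.re ∧ 0 < z.im} ∩ Metric.ball (0 : ℂ) (n + 2) ∩ U n) \ P := by
    have hball : ∀ᶠ y : ℝ in 𝓝[>] (0 : ℝ), (c : ℂ) + y * I ∈ Metric.ball (0 : ℂ) (n + 2) :=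
      (hpath.mono_right nhdsWithin_le_nhds).eventually (Metric.isOpen_ball.mem_nhds hcb)
    have hy0 : ∀ᶠ y : ℝ in 𝓝[>] (0 : ℝ), 0 < y := self_mem_nhdsWithin
    filter_upwards [hball, hpath.eventually (hUcod n (c : ℂ) hcb), hpath.eventually (hPcd (c : ℂ)), hy0] with y hyb hyU hyP hy
    refine ⟨⟨⟨⟨?_, ?_⟩, hyb⟩, hyU⟩, hyP⟩
    · simp only [add_re, ofReal_re, mul_re, I_re, I_im, ofReal_im, mul_zero, mul_one, sub_zero, add_zero]; exact hc
    · simp only [add_im, ofReal_im, mul_im, ofReal_re, I_im, I_re, mul_one, mul_zero, zero_add, add_zero]; exact hy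
  -- the (a3) clause on the line, then domination
  obtain ⟨Cd, hCd0, hCd⟩ := exists_norm_apply_le_norm_sum_smul he
  set A : ℝ := (c - 1 / 2) * T n ^ (2 * (c - 1 / 2)) * Real.sqrt (κ * m * ‖φ‖ ^ 2) +
    Real.sqrt ((c - 1 / 2) ^ 2 * T n ^ (4 * (c - 1 / 2)) * (κ * m * ‖φ‖ ^ 2) + (κ * m * ‖φ‖ ^ 2) * T n ^ (4 * (c - 1 / 2))) with hAdef
  have hA0 : 0 ≤ A := by
    have h1 : 0 ≤ c - 1 / 2 := by linarith
    have hT0 : 0 < T n := lt_of_lt_of_le one_pos (hT n)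
    positivity
  have hy1 : ∀ᶠ y : ℝ in 𝓝[>] (0 : ℝ), y < 1 := nhdsWithin_le_nhds (Iio_mem_nhds one_pos)
  have hy0 : ∀ᶠ y : ℝ in 𝓝[>] (0 : ℝ), 0 < y := self_mem_nhdsWithin
  have hrn : 0 < ‖r‖ := norm_pos_iff.2 hr
  refine ⟨Cd / ‖r‖ * (A / Real.sqrt (κ * m)), ?_⟩
  filter_upwards [hmem, hy1, hy0] with y hyD hy1' hy
  have h3 := (poleControl_continued_chi_cm_two_of_family_selfDual_on' hD₁o hD₁c hD₁sub hO₁o hO₁ne hO₁D hO₂o hO₂ne hO₂D hsep (hT n) (hcμ n) (hK n) hκ hm hφ hψd (F n) (hFd n hn)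
    (hrel n hn) hyD).2.2
  have hzre : ((c : ℂ) + y * I).re = c := by simp
  have hzim : ((c : ℂ) + y * I).im = y := by simp
  rw [hzre, hzim, abs_of_pos hy] at h3
  have hbox := h3 hy1'.le
  -- `y·‖ψ‖ ≤ A/√(κm)`
  have hψb : y * ‖ψ ((c : ℂ) + y * I)‖ ≤ A / Real.sqrt (κ * m) := mul_norm_le_of_boxClause (mul_pos hκ hm) hA0 hy hbox
  -- domination
  have hdom : ‖qc j ((c : ℂ) + y * I)‖ ≤ Cd / ‖r‖ * ‖ψ ((c : ℂ) + y * I)‖ := by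
    have h1 := hCd (fun i => qc i ((c : ℂ) + y * I)) j
    have h2 : ‖ψ ((c : ℂ) + y * I)‖ = ‖r‖ * ‖∑ i, qc i ((c : ℂ) + y * I) • e i‖ := by rw [hψ _ hyD.2, norm_smul]
    rw [h2, div_mul_eq_mul_div, mul_left_comm, mul_div_cancel_left₀ _ hrn.ne']
    exact h1
  calc y * ‖qc j ((c : ℂ) + y * I)‖ ≤ y * (Cd / ‖r‖ * ‖ψ ((c : ℂ) + y * I)‖) := mul_le_mul_of_nonneg_left hdom hy.le
    _ = Cd / ‖r‖ * (y * ‖ψ ((c : ℂ) + y * I)‖) := by ring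
    _ ≤ Cd / ‖r‖ * (A / Real.sqrt (κ * m)) := mul_le_mul_of_nonneg_left hψb (div_nonneg hCd0 hrn.le)

/-- **HEAD — THE THREE POLE LETTERS AT EVERY REAL `c > ½`** for the scattering coordinates and the intertwined section of a SELF-DUAL datum (letters: the `variable` block): (`hd∕hdw` per
coordinate) every `(z − c)·qc_j` extends analytically across `c` — the coordinates have AT MOST SIMPLE POLES on `(½, ∞)`; (`hd∕hdw` for the pairing) so does `(z − c)·κm⟪φ, ψ z⟫`; (`hb`)
`|z − c|²·κm‖ψ z‖²` is bounded on a punctured neighbourhood of `c` — the inputs of ★ `K2E1ChiMaassSelbergRealPoleCMTwo` ∕ ★ `K2E1MaassSelbergResiduePositivity` at the real poles `c ∈ S`.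
[cite: MoeglinWaldspurger1995, IV.1.11, IV.3.12 (a)] [cite: Langlands1976, §7] [cite: BernsteinLapid2019, §4] -/
theorem chi_realPole_letters_of_family_selfDual_balls {c : ℝ} (hc : 1 / 2 < c) :
    (∀ j, ∃ d : ℂ → ℂ, AnalyticAt ℂ d (c : ℂ) ∧ ∀ᶠ z : ℂ in 𝓝[≠] (c : ℂ), d z = (z - c) * qc j z) ∧
      (∃ d : ℂ → ℂ, AnalyticAt ℂ d (c : ℂ) ∧ ∀ᶠ z : ℂ in 𝓝[≠] (c : ℂ), d z = (z - c) * (((κ : ℝ) : ℂ) * (((m : ℝ) : ℂ) * ⟪φ, ψ z⟫_ℂ))) ∧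
      (∃ Mb : ℝ, ∀ᶠ z : ℂ in 𝓝[≠] (c : ℂ), ‖z - (c : ℂ)‖ ^ 2 * (κ * m * ‖ψ z‖ ^ 2) ≤ Mb) := by
  have hdj : ∀ j, ∃ d : ℂ → ℂ, AnalyticAt ℂ d (c : ℂ) ∧ ∀ᶠ z : ℂ in 𝓝[≠] (c : ℂ), d z = (z - c) * qc j z := by
    intro j
    obtain ⟨C, hC⟩ := vertical_bound_coords_of_family_selfDual_balls hPc hPcd hqa he hr hψ hκ hm hφ U hUo hUcod hT hcμ hK F hFd hrel hc j
    exact exists_analyticAt_eq_sub_mul_of_vertical_bound (hqNF j (mem_univ _)).meromorphicAt hC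
  have hψ' : ∀ᶠ z : ℂ in 𝓝[≠] (c : ℂ), ψ z = r • ∑ j, qc j z • e j := (hPcd (c : ℂ)).mono fun z hz => hψ z hz
  exact ⟨hdj, exists_analyticAt_pairing_of_coords e r φ κ m hψ' hdj, eventually_normSq_weight_le_of_coords e r (κ * m) hψ' hdj⟩

end Heads


end Summit.HodgeConjecture.HodgeConjecture.Cruxes.H413.K2E1ChiMaassSelbergRealPoleLettersCMTwo

end
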